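import Summits.ResolutionOfSingularities.ResolutionOfSingularities.Theorems.EquisingularLiftEquisingularLiftNatSaturatedLift
import Summits.ResolutionOfSingularities.ResolutionOfSingularities.Theorems.EquisingularLiftEquisingularLiftNatCarrierDeltaFlat
import HarnessLib

/-!
# [OURS · L1 W4.5(b) · EL♮(3) · D5 HOPEN, (IN-1) JOINT BIRTH, brick (B3)] THE KEY MODEL `(G̃)~ ⊂ ℙⁿ_O` OF ONE FORM:
# principal stalks, `≠ ⊥`, and `O`-FLAT when the reduction `θ G̃` is non-zero — ★ `KeyForm.keyModel_clauses`

res-type-027 g21 (desk RULING R59 2026-08-28T22:28Z: «(B3)+(B4) hypersurface model of a θ-lift in ℙ³_O + its trace = res-type-027»; statement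
VERBATIM from res-L1-w45b-stub-4 g12's interface file `L/res-L1-w45b-stub-4/KeyFormSIG.lean` 6e4862d4abec49c6, brick (B3) of the split of (IN-1)
`hBirth` of ✓ `TCPlus.opening_pointPhase` / ✓ `TCPlus.hopen_supplier_of₂`). Crux `EquisingularLiftNatThree` = stmt-ResolutionOfSingularities-20148
(parent stmt-…-20038), route `EquisingularLift`, line `sections`. OURS; NOT a statement of any manuscript ([Hironaka2017] is a candidate under
adjudication, nothing of it is asserted); AI-written, weaker than expert review. No `sorry`, no definition, no instance; standard axioms.
`--supports stmt-ResolutionOfSingularities-20148 --as helper`.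

WHAT. CURRENCY (stub-4's SIG file): the KEY MODEL of ONE form `F ∈ R[x₀,…,xₙ]_e` is the tree's ideal sheaf of the `Fin 1`-family
`𝓜 := projIdealSheaf R[x] ⟨span (range fun _ : Fin 1 ↦ F), isHomogeneous_span_of_forall_mem _ _ (fun _ ↦ e) (fun _ ↦ hF)⟩` on `ℙⁿ_R = Proj R[x]`
(`Literature/…/ProjHomogeneousIdealSheaf`, res-D-pv-027's CI-lift kit with `c = 1`). This file proves:
* `isPrincipal_stalkIdeal_keyModel` — EVERY stalk of `𝓜` is principal (at `y ∈ D₊(x_i)` it is spanned by the germ of `F / x_i^e`,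
  ✓ `CILift.stalkIdeal_projIdealSheaf_span`; every point lies on a chart, ✓ `SatLift.exists_mem_chart`);
* `keyModel_ne_bot` — `𝓜 ≠ ⊥` for `F ≠ 0` over a domain (its sections over `D₊(x₀)` are `(F / x₀^e) ≠ 0`);
* `mem_span_singleton_of_C_mul_mem` — `(F)` is `ϖ`-SATURATED when `θ F ≠ 0` (`θ : O ↠ k` onto a field, `O` a DVR): `C ϖ · y ∈ (F) ⇒ y ∈ (F)`
  (✓ `mem_span_of_C_mul_mem_of_map_ne_zero` of …NatCarrierDeltaFlat; `F mod ϖ ≠ 0` because `(ϖ) = 𝔪_O = ker θ`);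
* `flat_subschemeι_keyModel` — hence `V(𝓜) → Spec O` is FLAT (✓ `SatLift.flat_subschemeι_projIdealSheaf_of_saturated`);
* ★ `keyModel_clauses` — the three together, in the SIG file's dress (`… ≫ 𝟙 ℙⁿ_O ≫ q` as in `hBirth`).
The statements carry `letI := MvPolynomial.gradedAlgebra` at statement level (no instance attribute); they elaborate to the SIG file's types.

References: [Hartshorne1977, II Prop. 5.9, III Prop. 9.7]; tree kit (OURS, imported): …NatCompleteIntersectionLiftProj/Key (res-D-pv-027 AS
res-L1-s36-pv-4), …NatSaturatedLift (res-type-027 g14), …NatCarrierDeltaFlat.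
-/

set_option linter.dupNamespace false -- mandated namespace `Summit.<Summit>.<Problem>` of this single-conjunct summit
set_option linter.overlappingInstances false -- signatures carry `[IsDomain O] [IsDiscreteValuationRing O]`

noncomputable section

open CategoryTheory AlgebraicGeometry TopologicalSpace IsLocalRing
open MvPolynomial HomogeneousLocalization
open Literature.AlgebraicGeometry.Resolution

namespace Summit.ResolutionOfSingularities.ResolutionOfSingularities.Cruxes.EquisingularLiftNat.Sections

namespace KeyForm

/-! ## §1 Principal stalks; `≠ ⊥` -/

section OneForm

variable {R : Type} [CommRing R] {n : ℕ}

/-- **Every stalk of the key model `(F)~` is principal**: at `y ∈ D₊(x_i)` it is spanned by the germ of `F / x_i^e`, and every point of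
`ℙⁿ` lies on a standard chart. [cite: Hartshorne1977, II Prop. 5.9] -/
theorem isPrincipal_stalkIdeal_keyModel (F : MvPolynomial (Fin (n + 1)) R) (e : ℕ) (hF : F ∈ homogeneousSubmodule (Fin (n + 1)) R e) :
    letI := MvPolynomial.gradedAlgebra (σ := Fin (n + 1)) (R := R)
    ∀ z : ↥(Proj (homogeneousSubmodule (Fin (n + 1)) R)),
      (stalkIdeal (projIdealSheaf (homogeneousSubmodule (Fin (n + 1)) R)
        ⟨Ideal.span (Set.range fun _ : Fin 1 => F), isHomogeneous_span_of_forall_mem _ (fun _ : Fin 1 => F) (fun _ => e) (fun _ => hF)⟩) z).IsPrincipal := by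
  letI := MvPolynomial.gradedAlgebra (σ := Fin (n + 1)) (R := R)
  intro z
  obtain ⟨i, hzi⟩ := SatLift.exists_mem_chart (k := R) z
  rw [CILift.stalkIdeal_projIdealSheaf_span (fun _ : Fin 1 => F) (fun _ => e) (fun _ => hF) i z hzi, Set.range_const]
  exact ⟨⟨_, rfl⟩⟩

/-- **`(F)~ ≠ ⊥`** for a non-zero form over a domain: its sections over `D₊(x₀)` are spanned by `F / x₀^e ≠ 0`
(`Γ(ℙⁿ, D₊(x₀)) ≅ (R[x]_{x₀})₀`, and `x₀^m F ≠ 0`). [folklore] -/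
theorem keyModel_ne_bot [IsDomain R] (F : MvPolynomial (Fin (n + 1)) R) (e : ℕ) (hF : F ∈ homogeneousSubmodule (Fin (n + 1)) R e)
    (hF0 : F ≠ 0) :
    letI := MvPolynomial.gradedAlgebra (σ := Fin (n + 1)) (R := R)
    projIdealSheaf (homogeneousSubmodule (Fin (n + 1)) R)
        ⟨Ideal.span (Set.range fun _ : Fin 1 => F), isHomogeneous_span_of_forall_mem _ (fun _ : Fin 1 => F) (fun _ => e) (fun _ => hF)⟩ ≠ ⊥ := by
  letI := MvPolynomial.gradedAlgebra (σ := Fin (n + 1)) (R := R)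
  intro h
  have hch := projIdealSheaf_ideal_basicOpen_span (homogeneousSubmodule (Fin (n + 1)) R) (fun _ : Fin 1 => F) (fun _ => e) (fun _ => hF)
    (isHomogeneous_span_of_forall_mem _ (fun _ : Fin 1 => F) (fun _ => e) (fun _ => hF)) (CILift.X_mem_one' (0 : Fin (n + 1)))
  rw [h, Scheme.IdealSheafData.ideal_bot, Pi.bot_apply, Set.range_const, eq_comm, Ideal.span_singleton_eq_bot] at hch
  have hinj := (SatLift.awayToSection_bijective (k := R) (n := n) 0).1
  have h0 : mk₁ (homogeneousSubmodule (Fin (n + 1)) R) (CILift.X_mem_one' 0) e F hF = 0 :=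
    hinj (hch.trans (map_zero _).symm)
  rw [mk₁, Away.mk_eq_zero_iff] at h0
  obtain ⟨m, hm⟩ := h0
  exact (mul_ne_zero (pow_ne_zero m (X_ne_zero (0 : Fin (n + 1)))) hF0) hm

end OneForm

/-! ## §2 `O`-flatness of `V((F)~)` when `θ F ≠ 0` -/

section Flat

variable (O : Type) [CommRing O] [IsDomain O] [IsDiscreteValuationRing O] {k : Type} [Field k]
  (θ : O →+* k) (hθ : Function.Surjective θ) {n : ℕ}

include hθ in
/-- **`(F)` is `ϖ`-saturated when `θ F ≠ 0`**: `C ϖ · y ∈ (F) ⇒ y ∈ (F)` in `O[x]` (`F mod ϖ ≠ 0` because `(ϖ) = 𝔪_O = ker θ`;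
✓ `mem_span_of_C_mul_mem_of_map_ne_zero`). [folklore] -/
theorem mem_span_singleton_of_C_mul_mem (ϖ : O) (hϖ : Irreducible ϖ) (F : MvPolynomial (Fin (n + 1)) O)
    (hF0 : MvPolynomial.map θ F ≠ 0) (y : MvPolynomial (Fin (n + 1)) O) (hy : C ϖ * y ∈ Ideal.span {F}) :
    y ∈ Ideal.span {F} := by
  have hmax : maximalIdeal O = Ideal.span {ϖ} := (IsDiscreteValuationRing.irreducible_iff_uniformizer ϖ).mp hϖ
  have hprime : (Ideal.span {ϖ}).IsPrime := by rw [← hmax]; exact (maximalIdeal.isMaximal O).isPrime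
  refine mem_span_of_C_mul_mem_of_map_ne_zero hϖ.ne_zero hprime ?_ y hy
  intro h0
  apply hF0
  refine map_eq_zero_of_coeff_mem_ker θ fun m => ?_
  have hm := coeff_mem_ker_of_map_eq_zero _ h0 m
  rw [Ideal.mk_ker, ← hmax, ← IsLocalRing.eq_maximalIdeal (RingHom.ker_isMaximal_of_surjective θ hθ)] at hm
  exact hm

include hθ in
/-- **`V((F)~) → Spec O` is FLAT** for a form `F ∈ O[x₀,…,xₙ]_e` over a DVR `O` whose reduction along `θ : O ↠ k` is non-zero
(`ϖ`-saturation above + ✓ `SatLift.flat_subschemeι_projIdealSheaf_of_saturated`). [cite: Hartshorne1977, III Prop. 9.7] -/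
theorem flat_subschemeι_keyModel (F : MvPolynomial (Fin (n + 1)) O) (e : ℕ) (hF : F ∈ homogeneousSubmodule (Fin (n + 1)) O e)
    (hF0 : MvPolynomial.map θ F ≠ 0) :
    letI := MvPolynomial.gradedAlgebra (σ := Fin (n + 1)) (R := O)
    Flat ((projIdealSheaf (homogeneousSubmodule (Fin (n + 1)) O)
        ⟨Ideal.span (Set.range fun _ : Fin 1 => F), isHomogeneous_span_of_forall_mem _ (fun _ : Fin 1 => F) (fun _ => e) (fun _ => hF)⟩).subschemeι ≫
      (Proj.toSpecZero (homogeneousSubmodule (Fin (n + 1)) O) ≫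
        Spec.map (CommRingCat.ofHom (algebraMap O ((homogeneousSubmodule (Fin (n + 1)) O) 0))))) := by
  letI := MvPolynomial.gradedAlgebra (σ := Fin (n + 1)) (R := O)
  obtain ⟨ϖ, hϖ⟩ := IsDiscreteValuationRing.exists_irreducible O
  refine SatLift.flat_subschemeι_projIdealSheaf_of_saturated O ϖ hϖ (fun _ : Fin 1 => F) (fun _ => e) (fun _ => hF) ?_
  intro y hy
  rw [Set.range_const] at hy ⊢
  exact mem_span_singleton_of_C_mul_mem O θ hθ ϖ hϖ F hF0 y hy

include hθ in
/-- ★ **(B3) THE KEY MODEL'S CLAUSES** (res-L1-w45b-stub-4's `KeyFormSIG.lean`, VERBATIM): for a form `F ∈ O[x₀,…,xₙ]_e` over a DVR `O` with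
`θ F ≠ 0` (`θ : O ↠ k` onto a field), the key model `(F)~` has principal stalks, is `≠ ⊥`, and `V((F)~) → Spec O` is flat (in `hBirth`'s dress
`… ≫ 𝟙 ℙⁿ_O ≫ q`). [OURS · L1 W4.5b · D5 HOPEN (IN-1) brick (B3)] -/
theorem keyModel_clauses (F : MvPolynomial (Fin (n + 1)) O) (e : ℕ) (_he : 0 < e)
    (hF : F ∈ homogeneousSubmodule (Fin (n + 1)) O e) (hF0 : MvPolynomial.map θ F ≠ 0) :
    letI := MvPolynomial.gradedAlgebra (σ := Fin (n + 1)) (R := O)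
    (∀ z : Proj (homogeneousSubmodule (Fin (n + 1)) O),
        (stalkIdeal (projIdealSheaf (homogeneousSubmodule (Fin (n + 1)) O)
          ⟨Ideal.span (Set.range fun _ : Fin 1 => F), isHomogeneous_span_of_forall_mem _ (fun _ : Fin 1 => F) (fun _ => e) (fun _ => hF)⟩) z).IsPrincipal) ∧
      projIdealSheaf (homogeneousSubmodule (Fin (n + 1)) O)
          ⟨Ideal.span (Set.range fun _ : Fin 1 => F), isHomogeneous_span_of_forall_mem _ (fun _ : Fin 1 => F) (fun _ => e) (fun _ => hF)⟩ ≠ ⊥ ∧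
      Flat ((projIdealSheaf (homogeneousSubmodule (Fin (n + 1)) O)
          ⟨Ideal.span (Set.range fun _ : Fin 1 => F), isHomogeneous_span_of_forall_mem _ (fun _ : Fin 1 => F) (fun _ => e) (fun _ => hF)⟩).subschemeι ≫
        𝟙 (Proj (homogeneousSubmodule (Fin (n + 1)) O)) ≫ (Proj.toSpecZero (homogeneousSubmodule (Fin (n + 1)) O) ≫
          Spec.map (CommRingCat.ofHom (algebraMap O (homogeneousSubmodule (Fin (n + 1)) O 0))))) := by
  letI := MvPolynomial.gradedAlgebra (σ := Fin (n + 1)) (R := O)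
  have hF0' : F ≠ 0 := fun h => hF0 (by rw [h, map_zero])
  refine ⟨isPrincipal_stalkIdeal_keyModel F e hF, keyModel_ne_bot F e hF hF0', ?_⟩
  rw [Category.id_comp]
  exact flat_subschemeι_keyModel O θ hθ F e hF hF0

end Flat

end KeyForm

end Summit.ResolutionOfSingularities.ResolutionOfSingularities.Cruxes.EquisingularLiftNat.Sections

end
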